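import Literature.AnabelianGeometry.SemiGraphs.TemperoidsGaloisHomTorsor
import Literature.AnabelianGeometry.EtaleTheta.FrobenioidTheta

/-!
# [EtTh] §5, Thm. 5.7 (T-div) descent binders: the torsor laws of `A_N^bs → A_⊚^bs` and the Galois DESCENT of base
# automorphisms, PROVED over the genuine base category `B^temp(Π)⁰` ([SemiAnbd] Def. 3.1 (iv), Rmk. 3.1.3)

Mochizuki, *Semi-graphs of anabelioids*, Publ. RIMS **42** (2006), §3: Def. 3.1 (iv) p.33 («A connected object `T` … will be called
*Galois* if, for any two arrows `ψ₁, ψ₂ : S → T` …, where `S` is connected, there exists a[n] … automorphism `α ∈ Aut(T)` … such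
that `ψ₁ = α ∘ ψ₂`»), Rmk. 3.1.3 p.34 [cite: MochizukiSemiAnbd2006, Def 3.1(iv) p.33; Rmk 3.1.3 p.34];
Mochizuki, *The étale theta function …*, Publ. RIMS **45** (2009), §5 p.322 (PDF p.96) («`A_⊚^bs` … is 'characteristic' … hence, in
particular, Galois»), [FrdI] Def. 1.2 (iv) (Aut-ample objects) [cite: MochizukiEtTh2009, §5 p.322 (PDF p.96)].

Cell abc-iut, layer L2, seat abc-iut-L2-d3 (gen 7), row R532 «(T-div)».  PROOF-ONLY (0 definitions, no new named fact).
This seat's descent file `Discharge/Sec5Thm57DivTransportDescentToAcirc.lean` (p466310) carries two structural binders about the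
covering `φ : A_N → A_⊚` of the §5 data:
* `hGal` (abc-iut-w5-d245's, verbatim): `∀ p q : A_N^bs ⟶ A_⊚^bs, ∃ σ ∈ Aut(A_N^bs), σ ≫ p = q` — the SOURCE-torsor law
  (`A_N^bs` Galois, Def. 4.1 (iv)(a));
* `hGalDesc` (this seat's): `∀ σ ∈ Aut_D(A_N^bs), ∃ g ∈ Aut_C(A_⊚), σ ≫ φ^bs = φ^bs ≫ g^bs` — Galois DESCENT of base automorphisms
  of `A_N` to `C`-automorphisms of `A_⊚`.
Here both are DERIVED over the genuine base category `D := B^temp(Π)⁰` (`ConnectedPart (BTemp Π)`, the base of every tempered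
Frobenioid of the tree, [EtTh] Def. 3.6 (ii)) from print's inputs BY NAME:
* `GaloisObjects.exists_aut_comp_eq_of_isGaloisObj_target_connectedPart` — the TARGET-torsor law «`q = p ≫ τ` for some
  `τ ∈ Aut(T)`» for morphisms `p, q : A → T` INTO a Galois object `T` of `B^temp(Π)⁰` = Def. 3.1 (iv) VERBATIM (the tree's
  `IsGaloisObj`), packaged in the full subcategory;
* `ThetaFrobenioid.exists_aut_descends_of_targetTorsor_of_isAutAmple` — for ANY §5 data: the target-torsor law of
  `A_N^bs → A_⊚^bs` plus Aut-ampleness of `A_⊚` ([FrdI] Def. 1.2 (iv): `Aut_C(A_⊚) → Aut_D(A_⊚^bs)` surjective) give `hGalDesc`;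
* `ThetaFrobenioid.hGalDesc_connectedPart` / `hGal_connectedPart` — over `D = B^temp(Π)⁰`: `hGalDesc` ⟸ {`A_⊚^bs` Galois,
  `A_⊚` Aut-ample}, `hGal` ⟸ {`A_N^bs` Galois} — the binders of p466310 / p466917 reduced to print's sentences.
HONEST FRAMING: plain category theory over the tree's temperoid vocabulary; nothing of [EtTh] is asserted for an actual curve;
typed ≠ proved; no side taken on anything downstream ([IUTchIII] Cor. 3.12 in particular).
-/

open CategoryTheory

namespace Literature.AnabelianGeometry.SemiGraphs

namespace GaloisObjects

open Literature.AlgebraicGeometry.Frobenioids (IsConnectedObj ConnectedPart)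

universe u

variable {G : Type u} [Group G] [TopologicalSpace G]

/-- **Def. 3.1 (iv) in the full subcategory `B^temp(Π)⁰`**: for a Galois object `T` and morphisms `p, q : A → T` of
`B^temp(Π)⁰` (`A` connected — automatic) there is `τ ∈ Aut(T)` with `q = p ≫ τ` (post-composition; the TARGET-torsor law).
[cite: MochizukiSemiAnbd2006, Def 3.1(iv) p.33] -/
theorem exists_aut_comp_eq_of_isGaloisObj_target_connectedPart (A T : ConnectedPart (BTemp G)) (hT : IsGaloisObj T.obj)
    (p q : A ⟶ T) : ∃ τ : Aut T, q = p ≫ τ.hom := by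
  obtain ⟨α, hα⟩ := hT.2 A.obj A.property q.hom p.hom
  exact ⟨(Literature.AlgebraicGeometry.Frobenioids.connectedObjects (BTemp G)).isoMk α, ObjectProperty.hom_ext _ hα⟩

end GaloisObjects

end Literature.AnabelianGeometry.SemiGraphs

namespace Literature.AnabelianGeometry.EtaleTheta

namespace ThetaFrobenioid

open Literature.AnabelianGeometry.SemiGraphs Literature.AlgebraicGeometry.Frobenioids

universe w v v' u u' u₀

section Generic

variable {C : Type u} [Category.{v} C] {D : Type u'} [Category.{v'} D] (𝔉 : ThetaFrobenioid.{w} C D)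

/-- **Galois descent of base automorphisms along `φ : A_N → A_⊚`** from the TARGET-torsor law of `A_N^bs → A_⊚^bs` (`hGalT`:
`A_⊚^bs` Galois) and Aut-ampleness of `A_⊚` (`hAmp`, [FrdI] Def. 1.2 (iv)): every `σ ∈ Aut_D(A_N^bs)` satisfies
`σ ≫ φ^bs = φ^bs ≫ g^bs` for some `g ∈ Aut_C(A_⊚)` — the binder `hGalDesc` of `exists_baseCompatible_anchor_psiPhi_fixes_of_transport`.
[cite: MochizukiEtTh2009, §5 p.322 (PDF p.96)] -/
theorem exists_aut_descends_of_targetTorsor_of_isAutAmple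
    (hGalT : ∀ p q : 𝔉.base.obj 𝔉.AN ⟶ 𝔉.base.obj 𝔉.Acirc, ∃ t : Aut (𝔉.base.obj 𝔉.Acirc), q = p ≫ t.hom)
    (hAmp : 𝔉.IsAutAmple 𝔉.Acirc) (φ : 𝔉.AN ⟶ 𝔉.Acirc) (σ : Aut (𝔉.base.obj 𝔉.AN)) :
    ∃ g : Aut 𝔉.Acirc, σ.hom ≫ 𝔉.base.map φ = 𝔉.base.map φ ≫ 𝔉.base.map g.hom := by
  obtain ⟨t, ht⟩ := hGalT (𝔉.base.map φ) (σ.hom ≫ 𝔉.base.map φ)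
  obtain ⟨g, hg⟩ := hAmp t
  refine ⟨g, ?_⟩
  rw [ht, ← hg]
  rfl

/-- The SOURCE-torsor law in abc-iut-w5-d245's orientation (`σ ≫ p = q`) from the orientation `q = σ ≫ p`.
[cite: MochizukiSemiAnbd2006, Rmk 3.1.3 p.34] -/
theorem hGal_of_sourceTorsor
    (h : ∀ p q : 𝔉.base.obj 𝔉.AN ⟶ 𝔉.base.obj 𝔉.Acirc, ∃ σ : Aut (𝔉.base.obj 𝔉.AN), q = σ.hom ≫ p) :
    ∀ p q : 𝔉.base.obj 𝔉.AN ⟶ 𝔉.base.obj 𝔉.Acirc, ∃ σ : Aut (𝔉.base.obj 𝔉.AN), σ.hom ≫ p = q := fun p q => by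
  obtain ⟨σ, hσ⟩ := h p q
  exact ⟨σ, hσ.symm⟩

end Generic

section ConnectedPart

variable {C : Type u} [Category.{v} C] {G : Type u₀} [Group G] [TopologicalSpace G]
  (𝔉 : ThetaFrobenioid.{w} C (ConnectedPart (BTemp G)))

/-- **`hGalDesc` over the genuine base `B^temp(Π)⁰`** ⟸ {`A_⊚^bs` Galois («characteristic … hence Galois», §5 p.322), `A_⊚`
Aut-ample}. [cite: MochizukiEtTh2009, §5 p.322 (PDF p.96)] -/
theorem hGalDesc_connectedPart (hGalois : IsGaloisObj (𝔉.base.obj 𝔉.Acirc).obj) (hAmp : 𝔉.IsAutAmple 𝔉.Acirc)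
    (φ : 𝔉.AN ⟶ 𝔉.Acirc) :
    ∀ σ : Aut (𝔉.base.obj 𝔉.AN), ∃ g : Aut 𝔉.Acirc, σ.hom ≫ 𝔉.base.map φ = 𝔉.base.map φ ≫ 𝔉.base.map g.hom :=
  fun σ => 𝔉.exists_aut_descends_of_targetTorsor_of_isAutAmple
    (fun p q => GaloisObjects.exists_aut_comp_eq_of_isGaloisObj_target_connectedPart _ _ hGalois p q) hAmp φ σ

/-- **`hGal` over the genuine base `B^temp(Π)⁰`** ⟸ {`A_N^bs` Galois (Def. 4.1 (iv)(a))} — abc-iut-w5-d245's binder, via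
abc-iut-w4-d099's `exists_aut_comp_eq_of_isGaloisObj_connectedPart`. [cite: MochizukiSemiAnbd2006, Rmk 3.1.3 p.34] -/
theorem hGal_connectedPart (hGalois : IsGaloisObj (𝔉.base.obj 𝔉.AN).obj) :
    ∀ p q : 𝔉.base.obj 𝔉.AN ⟶ 𝔉.base.obj 𝔉.Acirc, ∃ σ : Aut (𝔉.base.obj 𝔉.AN), σ.hom ≫ p = q :=
  𝔉.hGal_of_sourceTorsor fun p q => GaloisObjects.exists_aut_comp_eq_of_isGaloisObj_connectedPart _ _ hGalois p q

end ConnectedPart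

end ThetaFrobenioid

end Literature.AnabelianGeometry.EtaleTheta
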